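/-
Copyright: statement-level skeleton of a published paper (lit-balaban cell, Phase-2 proof seat p25, gen 21). No proof
claims beyond what the kernel checks below.
-/
import Literature.MathematicalPhysics.QuantumFieldTheory.BalabanImbrieJaffe1984to88.BIJ88WalkIneq312RemainderBdryNC
import Literature.MathematicalPhysics.QuantumFieldTheory.BalabanImbrieJaffe1984to88.BIJ88WalkLocalTermCountW312
import Literature.MathematicalPhysics.QuantumFieldTheory.BalabanImbrieJaffe1984to88.BIJ88WalkWeightedLocalitySupports

/-!
# `BalabanImbrieJaffe1984to88.BIJ88WalkIneq312WeightedLocality` — T. Bałaban, J. Imbrie, A. Jaffe, *Effective action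
and cluster properties of the abelian Higgs model*, Commun. Math. Phys. **114** (1988) 257–315 [BalabanImbrieJaffe1988],
§5.14 p. 312 [PDF 56], verbatim (x2 render `lit-balaban-r16/renders/cmp114/original-p056-x2.png`): *"These
considerations lead to the following estimate: |G_k(X)| ≤ c(F(X))(e^β(L^kε/ε₀)^{1/4−α})^{β′|X∖∪_cX_c|} ×
Π_{X_{σ_1} ⊂ X : dist(X_{σ_1}, Λ₁₂^{(k)c}) < r(e_k)} [c(L^kε)^{−m(c)}e^{−m′(c)}]."* and p. 310 [PDF 54]: *"We give
random walk expansions for the propagators … The others, localized in region X, have a factor of e^{−cr(e_k)|X|}.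
We also consider as remainders any terms whose order in λ and e is greater than n̄."* and (after the W₆′ estimate)
*"(We allow adjustments in β, α, β′, keeping them small.)"* — **THE HEAD THEOREM OF ROW
C2.Claim@312 UNDER THE WEIGHTED LOCALITY OF THE INTERACTION** (p25 gen 21; file W3, a MEMBER of the row, owner r16,
referee ref-5; the head of record `BIJ88WalkIneq312RemainderBdry.ineq312_remainder_bdry` (r16 v2.284, ref-5 g68
CONCUR) and every earlier file UNCHANGED).

The head of record (and gen 21's `N`-head) take the locality of the interaction as the UNIFORM letter `N₀`: every
covariance piece `C_p` couples a direction `u` to at most `N₀` vertex legs, and `c_F(O) = K_χ·Λ_O·W_O^{Φ₀(O)}` with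
`W_O = max(1, ρ₀(Φ₀(O) + N₀))`.  For print's random-walk pieces the number of coupled legs grows with the walk and is
paid by the walk's weight `e^{−cr(e_k)|X|}`; for a split with a non-local piece `N₀` is the number of ALL vertex legs.
Here the head is stated with the WEIGHTED locality `Σ_p ρ_p·#{(m,j) : ⟨C_p u,(legs m)_j⟩ ≠ 0} ≤ ρ₁` (each piece pays
for its legs with its own weight) and `c_F(O) = K_χ·Λ_O·W_O^{Φ₀(O)}`, `W_O = max(1, ρ₀Φ₀(O) + ρ₁)` — assembled from
`BIJ88WalkIneq312RemainderBdryNC.ineq312_remainder_bdry_NC` (count abstracted) and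
`BIJ88WalkLocalTermCountW312.expand_lsum_init_le_W` (the weighted count).  The uniform hypotheses give the weighted
ones with `ρ₁ = ρ₀N₀` (`BIJ88WalkLocalCountW312.run_lsum_le_of_uniform`), and then `W_O` is the head's.

statement-level skeleton of published theorems with citation tags; proofs where landed; nothing here is a claim
about the Yang–Mills mass gap

PDF held: `paper:balaban1988-cmp114-bij-abelian-higgs-effective-action` (journal page = PDF page + 256); p. 312 =
PDF 56, p. 310 = PDF 54.

CITATION HEADER (lean-in-tree rule).  lit-balaban cell (HOME `run/shared/lean/pub/lit-balaban/`), Phase 2, seat p25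
gen 21; row **C2.Claim@312** of `HOME/lit-balaban-r16/ROWS-C2-part2.md` (owner r16, referee ref-5; MEMBER).  USED BY
NAME, nothing restated: the typed leaf `BIJ88Sect5StatementsPart4.Ineq312` (r16), `BIJ88WalkIneq312Remainder.{remSys,
phi0}`, `BIJ88WalkRemainderActivity312.{remAt, nfreeOf}`, `BIJ88WalkIneq312RemainderBdryNC.{ineq312_remainder_NC,
ineq312_remainder_bdry_NC}`,
`BIJ88WalkLocalTermCountW312.expand_lsum_init_le_W`, `BIJ88WalkWeightedLocalitySupports.weighted_locality_of_reach` (p25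
gen 21), the §5.13 model of record (`prec`, `src`, `corner`, `fieldLaw`).

## What is proved (0 `sorry`, standard axioms, no new `Prop` facts; theorems only, no definitions)

* `ineq312_remainder_W` (the sibling E2, all observables charged), **`ineq312_remainder_bdry_W`**: the head's
  statement in the currency `N` with `hN₀` replaced by the weighted locality `hρN` and `W_O = max(1, ρ₀Φ₀(O) + ρ₁)`; `weighted_locality_of_uniform` (`hN₀ ⇒ hρN` with `ρ₁ = ρ₀N₀`);
  gen 21's `N`-head `BIJ88WalkIneq312RemainderBdryN.ineq312_remainder_bdry_N` — EXACT statement — as an instance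
  (an `example`); **`ineq312_remainder_bdry_of_reach`** (the chain composed: `hρ₀`, `hρN` discharged by
  `BIJ88WalkWeightedLocalitySupports.weighted_locality_of_reach` from reach data, `W_O = max(1, ρ₀Φ₀(O) + Lρ₁)`).
HONEST SCOPE — head-question clauses as for the head with: currency `N ≥ 0`, `N 0 = 0`; C1's locality in weighted
form (`ρ₀`, `ρ₁` letters; print's `e^{−cr(e_k)|X|}` not instantiated — no walk expansion here); (H3) as printed,
boundary-restricted product under `hbeat`; (H4) boundary mechanism not modelled; (H5) pre-cluster-expansion.  NOT
summit progress; NOT continuum; NOT Clay.  Imports `BIJ88WalkIneq312RemainderBdryNC`, `BIJ88WalkLocalTermCountW312`,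
`BIJ88WalkWeightedLocalitySupports`; modifies nothing.
-/

noncomputable section

namespace Literature.MathematicalPhysics.QuantumFieldTheory.BalabanImbrieJaffe1984to88.BIJ88WalkIneq312WeightedLocality

open Classical MeasureTheory Matrix Finset
open scoped BigOperators
open Literature.MathematicalPhysics.QuantumFieldTheory.Balaban1983to89
open B2Eq228Conditioning (weight source)
open BIJ88PolymerRep5134 (corner)
open BIJ88PolymerRep5134Gauss (prec src)
open BIJ88SlotMomentsGauss308 (fieldLaw)
open BIJ88VertexIbp311 (vexp)
open BIJ88WickDerivatives305 (dlist)
open BIJ88VertexComponents311 (maxArity)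
open BIJ88WalkRun311 BIJ88WalkExpansion311 BIJ88WalkRemainderActivity312 BIJ88WalkIneq312Remainder
  BIJ88WalkIneq312RemainderBdryNC BIJ88WalkLocalTermCountW312 BIJ88WalkWeightedLocalitySupports

variable {ι : Type} [Fintype ι] {κ : Type} [LinearOrder κ] {P : Type} [Fintype P] {β : Type} [DecidableEq β]
variable {α I : Type} [Fintype α] [DecidableEq α] [Fintype I] [DecidableEq I]
  {blk : α → I} {Δ : Matrix α α ℝ} {ℱ : α → ℝ} {W : Finset I}

/-- **THE SIBLING E2 UNDER THE WEIGHTED LOCALITY** (all observables charged, `s^{#𝒳}` kept in `c_F`):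
`Ineq312 remSys (remAt(O,𝒳)/Z) (K_χ·Λ_O·W_O^{Φ₀(O)}·s^{#𝒳}) (Π_{j∈O} B_ℓ^{|obs j|}) (Σ_r #(X_r ∖ obs cubes)) θ 1`,
`W_O = max(1, ρ₀Φ₀(O) + ρ₁)`. [cite: BalabanImbrieJaffe1988, §5.14 p.310, p.312 (estimate preceding (5.14.5))] -/
theorem ineq312_remainder_W (hPD : (prec blk Δ W (corner ℝ W)).PosDef)
    {N : ({x : α // blk x ∈ W} → ℝ) → ℝ} (hN0 : ∀ z, 0 ≤ N z) (hNz : N 0 = 0)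
    {Cov : P → Matrix {x : α // blk x ∈ W} {x : α // blk x ∈ W} ℝ} {trig : P → Bool} {c : ι → ℝ}
    {legs : ι → List ({x : α // blk x ∈ W} → ℝ)} {obs : κ → List ({x : α // blk x ∈ W} → ℝ)} {M : ℕ}
    {χ : ({x : α // blk x ∈ W} → ℝ) → ℝ} {oc : κ → Finset β} {vc : ι → Finset β} {reg : P → Finset β}
    {Dir : Set ({x : α // blk x ∈ W} → ℝ)} {B' ρ : P → ℝ} {cV : ι → ℝ} {Bl θ θv θw ηχ ρ₀ ρ₁ Kχ : ℝ}
    {Λ : Finset κ → ℝ}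
    (hθ0 : 0 < θ) (hθ1 : θ ≤ 1) (hBl : 1 ≤ Bl) (hB0 : ∀ p, 0 ≤ B' p) (hρ : ∀ p, 0 ≤ ρ p) (hcV0 : ∀ m, 0 ≤ cV m)
    (hη0 : 0 ≤ ηχ) (hη1 : ηχ ≤ 1) (hθv : 0 < θv) (hθv1 : θv ≤ 1) (hθw : 0 < θw) (hθw1 : θw ≤ 1)
    (hB : ∀ p, ∀ u ∈ Dir, ∀ w ∈ Dir, |(Cov p *ᵥ u) ⬝ᵥ w| ≤ B' p * ρ p)
    (hBf : ∀ p, ∀ u ∈ Dir, |(Cov p *ᵥ u) ⬝ᵥ src blk ℱ W| ≤ B' p * ρ p)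
    (hBzN : ∀ p, ∀ u ∈ Dir, N (Cov p *ᵥ u) ≤ B' p * ρ p)
    (hcV : ∀ m, |c m| ≤ cV m) (hobs : ∀ j, ∀ w ∈ obs j, w ∈ Dir) (hlegs : ∀ m, ∀ w ∈ legs m, w ∈ Dir)
    (hloc : ∀ p, trig p = false → B' p ≤ Bl ∧ reg p = ∅) (hwalk : ∀ p, trig p = true → B' p ≤ θw * θ ^ (reg p).card)
    (hvert : ∀ m, cV m * Bl ^ (legs m).length ≤ θv * θ ^ (vc m).card) (hρ₀0 : 0 ≤ ρ₀)
    (hρ₀ : ∀ u ∈ Dir, (∑ p ∈ univ.filter (fun p => Cov p *ᵥ u ≠ 0), ρ p) ≤ ρ₀)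
    (hρN : ∀ u ∈ Dir, (∑ p, ρ p *
      ((∑ m, ((range (legs m).length).filter fun j => (Cov p *ᵥ u) ⬝ᵥ (legs m).getD j 0 ≠ 0).card : ℕ) : ℝ)) ≤ ρ₁)
    (hKχ : 0 ≤ Kχ) (hΛ : ∀ O, 0 ≤ Λ O)
    (hE : ∀ O : Finset κ, ∀ t ∈ expand Cov trig (src blk ℱ W) c legs obs M 0 O, t.consts = 0 →
      |∫ φ, ((t.groups.map fun h => (h.pend : Multiset _)).sum.map fun w => φ ⬝ᵥ w).prod
          * (dlist t.dirs χ φ * vexp c legs φ) ∂(fieldLaw blk Δ ℱ W)|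
        ≤ Kχ * (t.dirs.map fun z => ηχ * N z).prod * Λ O) :
    BIJ88Sect5StatementsPart4.Ineq312 (remSys κ β)
      (fun OX => remAt (prec blk Δ W (corner ℝ W)) Cov trig (src blk ℱ W) c legs obs M χ oc vc reg [] 0 OX.1 OX.2
        / ∫ φ, weight (prec blk Δ W (corner ℝ W)) φ * source (src blk ℱ W) φ)
      (fun OX => Kχ * Λ OX.1 * (max 1 (ρ₀ * (phi0 legs obs M OX.1 : ℝ) + ρ₁)) ^ phi0 legs obs M OX.1
        * (max ηχ (max (θv ^ M) θw)) ^ Multiset.card OX.2)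
      (fun OX => ∏ j ∈ OX.1, Bl ^ (obs j).length)
      (fun OX => nfreeOf oc OX.2) θ 1 :=
  ineq312_remainder_NC (oc := oc) (vc := vc) (reg := reg) (χ := χ)
    (C := fun O => (max 1 (ρ₀ * (phi0 legs obs M O : ℝ) + ρ₁)) ^ phi0 legs obs M O) hPD hN0 hNz hθ0 hθ1 hBl hB0 hρ
    hcV0 hη0 hη1 hθv hθv1 hθw hθw1 hB hBf hBzN hcV hobs hlegs hloc hwalk hvert
    (fun O => expand_lsum_init_le_W (trig := trig) (f := src blk ℱ W) (c := c) hobs hlegs hρ hρ₀0 hρ₀ hρN O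
      (le_max_left _ _) (le_max_right _ _))
    hKχ hΛ hE

/-- **THE HEAD THEOREM OF ROW C2.Claim@312 UNDER THE WEIGHTED LOCALITY OF THE INTERACTION** (currency `N`): the
hypotheses of gen 21's `BIJ88WalkIneq312RemainderBdryN.ineq312_remainder_bdry_N` with the uniform locality
`hN₀ : #{(m,j) : ⟨C_p u,(legs m)_j⟩ ≠ 0} ≤ N₀` replaced by `hρN : Σ_p ρ_p·#{(m,j) : ⟨C_p u,(legs m)_j⟩ ≠ 0} ≤ ρ₁`
(`u ∈ Dir`); conclusion the head's with `W_O = max(1, ρ₀Φ₀(O) + ρ₁)`: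
`Ineq312 remSys (remAt(O,𝒳)/Z) (K_χ·Λ_O·W_O^{Φ₀(O)}) (Π_{j∈O, j∈bdry} B_ℓ^{|obs j|}) (Σ_r #(X_r ∖ obs cubes)) θ 1` —
print's `|G_k(X)| ≤ c(F(X))(e^β(L^kε/ε₀)^{1/4−α})^{β′|X∖∪_cX_c|} × Π_{X_{σ_1} ⊂ X : dist(X_{σ_1}, Λ₁₂^{(k)c}) < r(e_k)}
[c(L^kε)^{−m(c)}e^{−m′(c)}]` for the located remainder families, pre-cluster-expansion.
[cite: BalabanImbrieJaffe1988, §5.14 p.310, p.312 (estimate preceding (5.14.5))] -/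
theorem ineq312_remainder_bdry_W (hPD : (prec blk Δ W (corner ℝ W)).PosDef)
    {N : ({x : α // blk x ∈ W} → ℝ) → ℝ} (hN0 : ∀ z, 0 ≤ N z) (hNz : N 0 = 0)
    {Cov : P → Matrix {x : α // blk x ∈ W} {x : α // blk x ∈ W} ℝ} {trig : P → Bool} {c : ι → ℝ}
    {legs : ι → List ({x : α // blk x ∈ W} → ℝ)} {obs : κ → List ({x : α // blk x ∈ W} → ℝ)} {M : ℕ}
    {χ : ({x : α // blk x ∈ W} → ℝ) → ℝ} {oc : κ → Finset β} {vc : ι → Finset β} {reg : P → Finset β}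
    {Dir : Set ({x : α // blk x ∈ W} → ℝ)} {B' ρ : P → ℝ} {cV : ι → ℝ} {Bl θ θv θw ηχ ρ₀ ρ₁ Kχ : ℝ}
    {Λ : Finset κ → ℝ}
    (hθ0 : 0 < θ) (hθ1 : θ ≤ 1) (hBl : 1 ≤ Bl) (hB0 : ∀ p, 0 ≤ B' p) (hρ : ∀ p, 0 ≤ ρ p) (hcV0 : ∀ m, 0 ≤ cV m)
    (hη0 : 0 ≤ ηχ) (hη1 : ηχ ≤ 1) (hθv : 0 < θv) (hθv1 : θv ≤ 1) (hθw : 0 < θw) (hθw1 : θw ≤ 1)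
    (hB : ∀ p, ∀ u ∈ Dir, ∀ w ∈ Dir, |(Cov p *ᵥ u) ⬝ᵥ w| ≤ B' p * ρ p)
    (hBf : ∀ p, ∀ u ∈ Dir, |(Cov p *ᵥ u) ⬝ᵥ src blk ℱ W| ≤ B' p * ρ p)
    (hBzN : ∀ p, ∀ u ∈ Dir, N (Cov p *ᵥ u) ≤ B' p * ρ p)
    (hcV : ∀ m, |c m| ≤ cV m) (hobs : ∀ j, ∀ w ∈ obs j, w ∈ Dir) (hlegs : ∀ m, ∀ w ∈ legs m, w ∈ Dir)
    (hloc : ∀ p, trig p = false → B' p ≤ Bl ∧ reg p = ∅) (hwalk : ∀ p, trig p = true → B' p ≤ θw * θ ^ (reg p).card)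
    (hvert : ∀ m, cV m * Bl ^ (legs m).length ≤ θv * θ ^ (vc m).card) (hρ₀0 : 0 ≤ ρ₀)
    (hρ₀ : ∀ u ∈ Dir, (∑ p ∈ univ.filter (fun p => Cov p *ᵥ u ≠ 0), ρ p) ≤ ρ₀)
    (hρN : ∀ u ∈ Dir, (∑ p, ρ p *
      ((∑ m, ((range (legs m).length).filter fun j => (Cov p *ᵥ u) ⬝ᵥ (legs m).getD j 0 ≠ 0).card : ℕ) : ℝ)) ≤ ρ₁)
    (hKχ : 0 ≤ Kχ) (hΛ : ∀ O, 0 ≤ Λ O)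
    (hE : ∀ O : Finset κ, ∀ t ∈ expand Cov trig (src blk ℱ W) c legs obs M 0 O, t.consts = 0 →
      |∫ φ, ((t.groups.map fun h => (h.pend : Multiset _)).sum.map fun w => φ ⬝ᵥ w).prod
          * (dlist t.dirs χ φ * vexp c legs φ) ∂(fieldLaw blk Δ ℱ W)|
        ≤ Kχ * (t.dirs.map fun z => ηχ * N z).prod * Λ O)
    (bdry : Finset κ)
    (hbeat : ∀ O : Finset κ, ∀ t ∈ expand Cov trig (src blk ℱ W) c legs obs M 0 O, t.consts = 0 → ∀ X ∈ t.groups,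
      max ηχ (max (θv ^ M) θw) * ∏ j ∈ X.lab.filter (fun j => j ∉ bdry), Bl ^ (obs j).length ≤ 1) :
    BIJ88Sect5StatementsPart4.Ineq312 (remSys κ β)
      (fun OX => remAt (prec blk Δ W (corner ℝ W)) Cov trig (src blk ℱ W) c legs obs M χ oc vc reg [] 0 OX.1 OX.2
        / ∫ φ, weight (prec blk Δ W (corner ℝ W)) φ * source (src blk ℱ W) φ)
      (fun OX => Kχ * Λ OX.1 * (max 1 (ρ₀ * (phi0 legs obs M OX.1 : ℝ) + ρ₁)) ^ phi0 legs obs M OX.1)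
      (fun OX => ∏ j ∈ OX.1.filter (fun j => j ∈ bdry), Bl ^ (obs j).length)
      (fun OX => nfreeOf oc OX.2) θ 1 :=
  ineq312_remainder_bdry_NC (oc := oc) (vc := vc) (reg := reg) (χ := χ)
    (C := fun O => (max 1 (ρ₀ * (phi0 legs obs M O : ℝ) + ρ₁)) ^ phi0 legs obs M O) hPD hN0 hNz hθ0 hθ1 hBl hB0 hρ
    hcV0 hη0 hη1 hθv hθv1 hθw hθw1 hB hBf hBzN hcV hobs hlegs hloc hwalk hvert
    (fun O => expand_lsum_init_le_W (trig := trig) (f := src blk ℱ W) (c := c) hobs hlegs hρ hρ₀0 hρ₀ hρN O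
      (le_max_left _ _) (le_max_right _ _))
    hKχ hΛ hE bdry hbeat

/-- **THE HEAD OF RECORD'S LOCALITY IS THE INSTANCE `ρ₁ = ρ₀N₀`**: under the head's uniform hypothesis `hN₀` the
weighted one holds with `ρ₁ = ρ₀·N₀` (a piece not seeing `u` couples to no leg), so `ineq312_remainder_bdry_W` applies
with `W_O = max(1, ρ₀Φ₀(O) + ρ₀N₀) = max(1, ρ₀(Φ₀(O) + N₀))`, the head's. [cite: BalabanImbrieJaffe1988, §5.14 p.311–312] -/
theorem weighted_locality_of_uniform {S : Type} [Fintype S] {Cov : P → Matrix S S ℝ} {legs : ι → List (S → ℝ)}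
    {Dir : Set (S → ℝ)} {ρ : P → ℝ} {ρ₀ : ℝ} {N₀ : ℕ} (hρ : ∀ p, 0 ≤ ρ p)
    (hρ₀ : ∀ u ∈ Dir, (∑ p ∈ univ.filter (fun p => Cov p *ᵥ u ≠ 0), ρ p) ≤ ρ₀)
    (hN₀ : ∀ p, ∀ u ∈ Dir,
      (∑ m, ((range (legs m).length).filter fun j => (Cov p *ᵥ u) ⬝ᵥ (legs m).getD j 0 ≠ 0).card) ≤ N₀) :
    ∀ u ∈ Dir, (∑ p, ρ p *
      ((∑ m, ((range (legs m).length).filter fun j => (Cov p *ᵥ u) ⬝ᵥ (legs m).getD j 0 ≠ 0).card : ℕ) : ℝ))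
        ≤ ρ₀ * N₀ := by
  intro u hu
  have hz : ∀ p, Cov p *ᵥ u = 0 →
      (∑ m, ((range (legs m).length).filter fun j => (Cov p *ᵥ u) ⬝ᵥ (legs m).getD j 0 ≠ 0).card) = 0 :=
    fun p hp => Finset.sum_eq_zero fun m _ => by
      rw [Finset.card_eq_zero, Finset.filter_eq_empty_iff]
      intro j _ h
      exact h (by rw [hp, zero_dotProduct])
  calc ∑ p, ρ p * ((∑ m, ((range (legs m).length).filter
          fun j => (Cov p *ᵥ u) ⬝ᵥ (legs m).getD j 0 ≠ 0).card : ℕ) : ℝ)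
      = ∑ p ∈ univ.filter (fun p => Cov p *ᵥ u ≠ 0), ρ p * ((∑ m, ((range (legs m).length).filter
          fun j => (Cov p *ᵥ u) ⬝ᵥ (legs m).getD j 0 ≠ 0).card : ℕ) : ℝ) := by
        rw [Finset.sum_filter]
        refine Finset.sum_congr rfl fun p _ => ?_
        by_cases hp : Cov p *ᵥ u = 0
        · rw [if_neg (not_not.2 hp), hz p hp, Nat.cast_zero, mul_zero]
        · rw [if_pos hp]
    _ ≤ ∑ p ∈ univ.filter (fun p => Cov p *ᵥ u ≠ 0), ρ p * (N₀ : ℝ) :=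
        Finset.sum_le_sum fun p _ => mul_le_mul_of_nonneg_left (by exact_mod_cast hN₀ p u hu) (hρ p)
    _ ≤ ρ₀ * N₀ := by rw [← Finset.sum_mul]; exact mul_le_mul_of_nonneg_right (hρ₀ u hu) (Nat.cast_nonneg _)

/-- **GEN 21's `N`-HEAD (HENCE THE HEAD OF RECORD) IS THE INSTANCE `ρ₁ = ρ₀N₀` OF THE WEIGHTED HEAD**: the EXACT
statement of `BIJ88WalkIneq312RemainderBdryN.ineq312_remainder_bdry_N`, obtained from `ineq312_remainder_bdry_W`
and `weighted_locality_of_uniform` (`max(1, ρ₀Φ₀ + ρ₀N₀) = max(1, ρ₀(Φ₀ + N₀))`) — kernel-checked as an `example`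
(`dedup.landed`: no second name for a landed statement). [cite: BalabanImbrieJaffe1988, §5.14 p.312] -/
example (hPD : (prec blk Δ W (corner ℝ W)).PosDef)
    {N : ({x : α // blk x ∈ W} → ℝ) → ℝ} (hN0 : ∀ z, 0 ≤ N z) (hNz : N 0 = 0)
    {Cov : P → Matrix {x : α // blk x ∈ W} {x : α // blk x ∈ W} ℝ} {trig : P → Bool} {c : ι → ℝ}
    {legs : ι → List ({x : α // blk x ∈ W} → ℝ)} {obs : κ → List ({x : α // blk x ∈ W} → ℝ)} {M : ℕ}
    {χ : ({x : α // blk x ∈ W} → ℝ) → ℝ} {oc : κ → Finset β} {vc : ι → Finset β} {reg : P → Finset β}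
    {Dir : Set ({x : α // blk x ∈ W} → ℝ)} {B' ρ : P → ℝ} {cV : ι → ℝ} {Bl θ θv θw ηχ ρ₀ Kχ : ℝ} {Λ : Finset κ → ℝ}
    {N₀ : ℕ}
    (hθ0 : 0 < θ) (hθ1 : θ ≤ 1) (hBl : 1 ≤ Bl) (hB0 : ∀ p, 0 ≤ B' p) (hρ : ∀ p, 0 ≤ ρ p) (hcV0 : ∀ m, 0 ≤ cV m)
    (hη0 : 0 ≤ ηχ) (hη1 : ηχ ≤ 1) (hθv : 0 < θv) (hθv1 : θv ≤ 1) (hθw : 0 < θw) (hθw1 : θw ≤ 1)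
    (hB : ∀ p, ∀ u ∈ Dir, ∀ w ∈ Dir, |(Cov p *ᵥ u) ⬝ᵥ w| ≤ B' p * ρ p)
    (hBf : ∀ p, ∀ u ∈ Dir, |(Cov p *ᵥ u) ⬝ᵥ src blk ℱ W| ≤ B' p * ρ p)
    (hBzN : ∀ p, ∀ u ∈ Dir, N (Cov p *ᵥ u) ≤ B' p * ρ p)
    (hcV : ∀ m, |c m| ≤ cV m) (hobs : ∀ j, ∀ w ∈ obs j, w ∈ Dir) (hlegs : ∀ m, ∀ w ∈ legs m, w ∈ Dir)
    (hloc : ∀ p, trig p = false → B' p ≤ Bl ∧ reg p = ∅) (hwalk : ∀ p, trig p = true → B' p ≤ θw * θ ^ (reg p).card)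
    (hvert : ∀ m, cV m * Bl ^ (legs m).length ≤ θv * θ ^ (vc m).card) (hρ₀0 : 0 ≤ ρ₀)
    (hρ₀ : ∀ u ∈ Dir, (∑ p ∈ univ.filter (fun p => Cov p *ᵥ u ≠ 0), ρ p) ≤ ρ₀)
    (hN₀ : ∀ p, ∀ u ∈ Dir,
      (∑ m, ((range (legs m).length).filter fun j => (Cov p *ᵥ u) ⬝ᵥ (legs m).getD j 0 ≠ 0).card) ≤ N₀)
    (hKχ : 0 ≤ Kχ) (hΛ : ∀ O, 0 ≤ Λ O)
    (hE : ∀ O : Finset κ, ∀ t ∈ expand Cov trig (src blk ℱ W) c legs obs M 0 O, t.consts = 0 →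
      |∫ φ, ((t.groups.map fun h => (h.pend : Multiset _)).sum.map fun w => φ ⬝ᵥ w).prod
          * (dlist t.dirs χ φ * vexp c legs φ) ∂(fieldLaw blk Δ ℱ W)|
        ≤ Kχ * (t.dirs.map fun z => ηχ * N z).prod * Λ O)
    (bdry : Finset κ)
    (hbeat : ∀ O : Finset κ, ∀ t ∈ expand Cov trig (src blk ℱ W) c legs obs M 0 O, t.consts = 0 → ∀ X ∈ t.groups,
      max ηχ (max (θv ^ M) θw) * ∏ j ∈ X.lab.filter (fun j => j ∉ bdry), Bl ^ (obs j).length ≤ 1) :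
    BIJ88Sect5StatementsPart4.Ineq312 (remSys κ β)
      (fun OX => remAt (prec blk Δ W (corner ℝ W)) Cov trig (src blk ℱ W) c legs obs M χ oc vc reg [] 0 OX.1 OX.2
        / ∫ φ, weight (prec blk Δ W (corner ℝ W)) φ * source (src blk ℱ W) φ)
      (fun OX => Kχ * Λ OX.1 * (max 1 (ρ₀ * ((phi0 legs obs M OX.1 + N₀ : ℕ) : ℝ))) ^ phi0 legs obs M OX.1)
      (fun OX => ∏ j ∈ OX.1.filter (fun j => j ∈ bdry), Bl ^ (obs j).length)
      (fun OX => nfreeOf oc OX.2) θ 1 := by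
  have key := ineq312_remainder_bdry_W (oc := oc) (vc := vc) (reg := reg) (χ := χ) hPD hN0 hNz hθ0 hθ1 hBl hB0 hρ
    hcV0 hη0 hη1 hθv hθv1 hθw hθw1 hB hBf hBzN hcV hobs hlegs hloc hwalk hvert hρ₀0 hρ₀
    (weighted_locality_of_uniform hρ hρ₀ hN₀) hKχ hΛ hE bdry hbeat
  have e : ∀ O : Finset κ, max 1 (ρ₀ * ((phi0 legs obs M O + N₀ : ℕ) : ℝ))
      = max 1 (ρ₀ * (phi0 legs obs M O : ℝ) + ρ₀ * N₀) := fun O => by push_cast; rw [mul_add]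
  simp_rw [e]
  exact key

/-- **THE HEAD UNDER GEOMETRIC LOCALITY DATA** (the chain composed): the weighted head `ineq312_remainder_bdry_W` with
its locality hypotheses `hρ₀`, `hρN` DISCHARGED by `BIJ88WalkWeightedLocalitySupports.weighted_locality_of_reach`
from the reach of the pieces (`sees p k`, `reach p k` per direction cube; `C_X` region-local, `C_loc` range-local),
one-cube directions and vertex legs (at most `L` per cube) and the per-cube weight sums `ρ₀`, `ρ₁`
(`BIJ88WalkRegionWeightsSummable` for the region pieces); `W_O = max(1, ρ₀Φ₀(O) + Lρ₁)`.
[cite: BalabanImbrieJaffe1988, §5.14 p.310, p.312 (estimate preceding (5.14.5)), Sect. 2 p.264–265] -/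
theorem ineq312_remainder_bdry_of_reach (hPD : (prec blk Δ W (corner ℝ W)).PosDef)
    {N : ({x : α // blk x ∈ W} → ℝ) → ℝ} (hN0 : ∀ z, 0 ≤ N z) (hNz : N 0 = 0)
    {Cov : P → Matrix {x : α // blk x ∈ W} {x : α // blk x ∈ W} ℝ} {trig : P → Bool} {c : ι → ℝ}
    {legs : ι → List ({x : α // blk x ∈ W} → ℝ)} {obs : κ → List ({x : α // blk x ∈ W} → ℝ)} {M : ℕ}
    {χ : ({x : α // blk x ∈ W} → ℝ) → ℝ} {oc : κ → Finset β} {vc : ι → Finset β} {reg : P → Finset β}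
    {Dir : Set ({x : α // blk x ∈ W} → ℝ)} {B' ρ : P → ℝ} {cV : ι → ℝ} {Bl θ θv θw ηχ ρ₀ ρ₁ Kχ : ℝ}
    {Λ : Finset κ → ℝ} {K : Type} {cubeOf : {x : α // blk x ∈ W} → K} {sees : P → K → Prop}
    {reach : P → K → Finset K} {legCube : ι → ℕ → K} {L : ℕ}
    (hθ0 : 0 < θ) (hθ1 : θ ≤ 1) (hBl : 1 ≤ Bl) (hB0 : ∀ p, 0 ≤ B' p) (hρ : ∀ p, 0 ≤ ρ p) (hcV0 : ∀ m, 0 ≤ cV m)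
    (hη0 : 0 ≤ ηχ) (hη1 : ηχ ≤ 1) (hθv : 0 < θv) (hθv1 : θv ≤ 1) (hθw : 0 < θw) (hθw1 : θw ≤ 1)
    (hB : ∀ p, ∀ u ∈ Dir, ∀ w ∈ Dir, |(Cov p *ᵥ u) ⬝ᵥ w| ≤ B' p * ρ p)
    (hBf : ∀ p, ∀ u ∈ Dir, |(Cov p *ᵥ u) ⬝ᵥ src blk ℱ W| ≤ B' p * ρ p)
    (hBzN : ∀ p, ∀ u ∈ Dir, N (Cov p *ᵥ u) ≤ B' p * ρ p)
    (hcV : ∀ m, |c m| ≤ cV m) (hobs : ∀ j, ∀ w ∈ obs j, w ∈ Dir) (hlegs : ∀ m, ∀ w ∈ legs m, w ∈ Dir)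
    (hloc : ∀ p, trig p = false → B' p ≤ Bl ∧ reg p = ∅) (hwalk : ∀ p, trig p = true → B' p ≤ θw * θ ^ (reg p).card)
    (hvert : ∀ m, cV m * Bl ^ (legs m).length ≤ θv * θ ^ (vc m).card) (hρ₀0 : 0 ≤ ρ₀)
    (hin : ∀ p (u : {x : α // blk x ∈ W} → ℝ) k, (∀ y, u y ≠ 0 → cubeOf y = k) → Cov p *ᵥ u ≠ 0 → sees p k)
    (hout : ∀ p (u : {x : α // blk x ∈ W} → ℝ) k, (∀ y, u y ≠ 0 → cubeOf y = k) →
      ∀ x, (Cov p *ᵥ u) x ≠ 0 → cubeOf x ∈ reach p k)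
    (hDir : ∀ u ∈ Dir, ∃ k, ∀ y, u y ≠ 0 → cubeOf y = k)
    (hleg : ∀ m j x, ((legs m).getD j 0) x ≠ 0 → cubeOf x = legCube m j)
    (hL : ∀ k, (∑ m, ((range (legs m).length).filter fun j => legCube m j = k).card) ≤ L)
    (hρ₀ : ∀ k, (∑ p ∈ univ.filter (fun p => sees p k), ρ p) ≤ ρ₀)
    (hρ₁ : ∀ k, (∑ p ∈ univ.filter (fun p => sees p k), ρ p * (reach p k).card) ≤ ρ₁)
    (hKχ : 0 ≤ Kχ) (hΛ : ∀ O, 0 ≤ Λ O)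
    (hE : ∀ O : Finset κ, ∀ t ∈ expand Cov trig (src blk ℱ W) c legs obs M 0 O, t.consts = 0 →
      |∫ φ, ((t.groups.map fun h => (h.pend : Multiset _)).sum.map fun w => φ ⬝ᵥ w).prod
          * (dlist t.dirs χ φ * vexp c legs φ) ∂(fieldLaw blk Δ ℱ W)|
        ≤ Kχ * (t.dirs.map fun z => ηχ * N z).prod * Λ O)
    (bdry : Finset κ)
    (hbeat : ∀ O : Finset κ, ∀ t ∈ expand Cov trig (src blk ℱ W) c legs obs M 0 O, t.consts = 0 → ∀ X ∈ t.groups,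
      max ηχ (max (θv ^ M) θw) * ∏ j ∈ X.lab.filter (fun j => j ∉ bdry), Bl ^ (obs j).length ≤ 1) :
    BIJ88Sect5StatementsPart4.Ineq312 (remSys κ β)
      (fun OX => remAt (prec blk Δ W (corner ℝ W)) Cov trig (src blk ℱ W) c legs obs M χ oc vc reg [] 0 OX.1 OX.2
        / ∫ φ, weight (prec blk Δ W (corner ℝ W)) φ * source (src blk ℱ W) φ)
      (fun OX => Kχ * Λ OX.1 * (max 1 (ρ₀ * (phi0 legs obs M OX.1 : ℝ) + L * ρ₁)) ^ phi0 legs obs M OX.1)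
      (fun OX => ∏ j ∈ OX.1.filter (fun j => j ∈ bdry), Bl ^ (obs j).length)
      (fun OX => nfreeOf oc OX.2) θ 1 :=
  have hWL := weighted_locality_of_reach (Cov := Cov) (legs := legs) (Dir := Dir) hin hout hDir hleg hL hρ hρ₀ hρ₁
  ineq312_remainder_bdry_W (oc := oc) (vc := vc) (reg := reg) (χ := χ) hPD hN0 hNz hθ0 hθ1 hBl hB0 hρ hcV0 hη0 hη1
    hθv hθv1 hθw hθw1 hB hBf hBzN hcV hobs hlegs hloc hwalk hvert hρ₀0 hWL.1 hWL.2 hKχ hΛ hE bdry hbeat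

end Literature.MathematicalPhysics.QuantumFieldTheory.BalabanImbrieJaffe1984to88.BIJ88WalkIneq312WeightedLocality

end
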